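import Literature.MathematicalPhysics.QuantumLattice.CentreSymmetryConfinementProofs
import Literature.MathematicalPhysics.QuantumLattice.LatticeGaugeDLRGibbsProofs
import Literature.MathematicalPhysics.QuantumLattice.LatticeGaugeDLRProofs
import Literature.MathematicalPhysics.QuantumLattice.LatticeGaugeDLRBoxKernels
import Literature.MathematicalPhysics.QuantumFieldTheory.LatticeGaugeAsymptotics
import Literature.MathematicalPhysics.QuantumFieldTheory.LatticeGaugeProofs
import Literature.MathematicalPhysics.QuantumLattice.WilsonBlockHeatBathSemigroup
import Literature.MathematicalPhysics.QuantumLattice.WilsonBlockHeatBathMarkov3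
import Literature.Probability.LatticeModels.TorusCentredLift
import Summits.QuantumFields.YangMills.Theorems.IR.Negative.OnsetMixingTypicalFalseOfMassWire

/-!
# Fixed-mesh negative for format T, part 1/6: the layer twist `τ_k` (a gauge transformation) and the Wilson-kernel symmetry

Part of the fixed-mesh negative for format T of crux `IR` (stmt-QuantumFields-19354, registered cut `af-pincer-T`
sha16 0308f95ca6f6a115); headline module `Theorems/IR/Negative/TypShellCondFalseFixedMesh.lean` (statement, provenance,
reading).  Content re-homed verbatim from the crux workfile `Cruxes/IR/CruxIdea8FixedMesh.lean` (cruxidea-8 GEN 5,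
tree sha16 d880b42bb52976de) under the namespace `Summit.QuantumFields.YangMills.Cruxes.IR.FixedMesh`; sorry-free.
-/

set_option autoImplicit false

noncomputable section

open MeasureTheory Filter Topology
open Literature.MathematicalPhysics.QuantumLattice
open Literature.Probability.LatticeModels
open Summit.QuantumFields.YangMills.Cruxes.IR.Tempered (cellEdges windowCells regionEdges)
open Summit.QuantumFields.YangMills.Cruxes.IR.ShellTempered (windowCellsPlus)
open Summit.QuantumFields.YangMills.Cruxes.IR.OnsetFormats (TypShellCond shellCount OnsetMixingTypical)

namespace Summit.QuantumFields.YangMills.Cruxes.IR.FixedMesh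

/-! ## §0 The layer twist is a gauge transformation -/

section Geometry

variable {G : Type} [Group G]

/-- The layer-`k` centre twist `τ_k`: multiply every vertical link `(x, 0)` with `x 0 = k` on the left by `g₀`
(GEN 2 `layerTwist`; Chatterjee's `τ` = tree `centreTransform` is `k = 0`). -/
def layerTwist (k : ℤ) (g₀ : G) (U : LGConfig 4 G) : LGConfig 4 G :=
  fun e => if e.2 = 0 ∧ e.1 0 = k then g₀ * U e else U e

/-- `τ_0` is the tree's centre transform (definitional). -/
theorem layerTwist_zero (g₀ : G) : layerTwist (G := G) 0 g₀ = centreTransform g₀ := rfl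

/-- The half-space gauge function `h_k(x) = g₀` if `x 0 ≤ k`, `= 1` above. -/
def slabGauge (k : ℤ) (g₀ : G) : Site 4 → G :=
  fun x => if x 0 ≤ k then g₀ else 1

/-- **PROVED (S). The centre twist is a gauge transformation:** `τ_k U = U^{h_k}` for central `g₀`
(vertical links at layer `k` pick up `g₀ · 1⁻¹`; every other link is conjugated by `g₀` or by `1`). -/
theorem layerTwist_eq_gaugeTransformZd {g₀ : G} (hg : g₀ ∈ Subgroup.center G) (k : ℤ) :
    layerTwist k g₀ = gaugeTransformZd (slabGauge k g₀) := by
  have hconj : ∀ g : G, g₀ * g * g₀⁻¹ = g := fun g => by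
    rw [← Subgroup.mem_center_iff.1 hg g, mul_inv_cancel_right]
  funext U e
  obtain ⟨x, i⟩ := e
  have h0 : ((x + Pi.single i (1 : ℤ) : Site 4)) 0 = x 0 + (if (0 : Fin 4) = i then 1 else 0) := by
    simp [Pi.single_apply]
  simp only [layerTwist, gaugeTransformZd, slabGauge, h0]
  by_cases hi : i = 0
  · subst hi
    by_cases hk : x 0 = k
    · have h1 : x 0 ≤ k := hk.le
      have h2 : ¬ (x 0 + 1 ≤ k) := by omega
      simp [hk]
    · by_cases hle : x 0 ≤ k
      · have h2 : x 0 + 1 ≤ k := by omega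
        simp [hk, hle, h2, hconj]
      · have h2 : ¬ (x 0 + 1 ≤ k) := by omega
        simp [hk, hle, h2]
  · have hi' : ¬ ((0 : Fin 4) = i) := fun h => hi h.symm
    by_cases hle : x 0 ≤ k
    · simp [hi, hi', hle, hconj]
    · simp [hi, hi', hle]

/-- **PROVED.** Every gauge-invariant data predicate (of ANY range) accepts `τ_k ζ` iff it accepts `ζ`. -/
theorem mem_layerTwist_iff {T : Set (LGConfig 4 G)}
    (hT : ∀ (h : Site 4 → G) (U : LGConfig 4 G), gaugeTransformZd h U ∈ T ↔ U ∈ T)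
    {g₀ : G} (hg : g₀ ∈ Subgroup.center G) (k : ℤ) (ζ : LGConfig 4 G) :
    layerTwist k g₀ ζ ∈ T ↔ ζ ∈ T := by
  rw [layerTwist_eq_gaugeTransformZd hg]
  exact hT _ _

/-- The standard mesh-`b` frame (GEN 2): cell-row `0` occupies the time layers `1, …, b`, widths exactly `b`. -/
def stdFrame (b : ℕ) : Fin 4 → ℤ → ℤ :=
  fun i j => if i = 0 then (b : ℤ) * j + 1 else (b : ℤ) * j

/-- **PROVED.** The standard frame is admissible (`w i j + b ≤ w i (j+1) ≤ w i j + 2b`). -/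
theorem stdFrame_admissible (b : ℕ) :
    ∀ i j, stdFrame b i j + ((b : ℕ) : ℤ) ≤ stdFrame b i (j + 1) ∧
      stdFrame b i (j + 1) ≤ stdFrame b i j + 2 * ((b : ℕ) : ℤ) := by
  intro i j
  have hb : (0 : ℤ) ≤ (b : ℤ) := Int.natCast_nonneg b
  unfold stdFrame
  split_ifs <;> constructor <;> nlinarith

/-- The window cells of row `0` (`y 0 = 0`): the SLAB-LIKE resampled region of the twist pair. -/
def rowCells (n : ℕ) : Finset (Fin 4 → ℤ) :=
  (windowCells n).filter fun y => y 0 = 0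

/-- **PROVED.** `rowCells n ⊆ windowCells n`. -/
theorem rowCells_subset (n : ℕ) : rowCells n ⊆ windowCells n := Finset.filter_subset _ _

/-- **PROVED.** `0 ∈ rowCells n`. -/
theorem zero_mem_rowCells (n : ℕ) : (0 : Fin 4 → ℤ) ∈ rowCells n := by
  refine Finset.mem_filter.2 ⟨?_, rfl⟩
  simp only [windowCells, Fintype.mem_piFinset, Pi.zero_apply, Finset.mem_Icc]
  intro _
  constructor <;> omega

/-- The resampled region `Λ = ⋃_{y ∈ row 0} cellEdges` (tree `regionEdges`/`cellEdges` conventions). -/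
def rowRegion (b n : ℕ) : Finset (ZdEdge 4) :=
  regionEdges (stdFrame b) (rowCells n)

/-- **PROVED (S). Agreement off the row:** for `1 ≤ k ≤ b` the twist `τ_k` changes no edge of a window cell off
row `0` — the (i_T) agreement hypothesis for the pair `(ζ, τ_k ζ)` at `Y = rowCells n`. -/
theorem layerTwist_agree_off_row {b n : ℕ} {k : ℤ} (hk : 1 ≤ k ∧ k ≤ (b : ℤ)) (g₀ : G) (ζ : LGConfig 4 G) :
    ∀ c ∈ windowCellsPlus n, c ∉ rowCells n → c ∈ windowCells n →
      ∀ e ∈ cellEdges (stdFrame b) c, ζ e = layerTwist k g₀ ζ e := by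
  intro c _ hcr hcw e he
  have hc0 : c 0 ≠ 0 := fun h => hcr (Finset.mem_filter.2 ⟨hcw, h⟩)
  have he1 : stdFrame b 0 (c 0) ≤ e.1 0 ∧ e.1 0 < stdFrame b 0 (c 0 + 1) := by
    have h := Fintype.mem_piFinset.1 (Finset.mem_product.1 he).1 0
    exact Finset.mem_Ico.1 h
  simp only [stdFrame, if_true] at he1
  unfold layerTwist
  by_cases h : e.2 = 0 ∧ e.1 0 = k
  · exfalso
    have hb : (0 : ℤ) ≤ (b : ℤ) := Int.natCast_nonneg b
    rcases lt_or_gt_of_ne hc0 with hneg | hpos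
    · have : (b : ℤ) * (c 0 + 1) ≤ 0 := mul_nonpos_of_nonneg_of_nonpos hb (by omega)
      omega
    · have : (b : ℤ) * 1 ≤ (b : ℤ) * c 0 := mul_le_mul_of_nonneg_left (by omega) hb
      omega
  · rw [if_neg h]

end Geometry

/-! ## §1 Kernel symmetry from gauge covariance; the charged identity; twist-blindness of invariant tests -/

section Symmetry

variable {G : Type} [Group G] [TopologicalSpace G] [IsTopologicalGroup G] [CompactSpace G]
  [SecondCountableTopology G] [MeasurableSpace G] [BorelSpace G]
  {N : ℕ} (ρ : G →* Matrix (Fin N) (Fin N) ℂ)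

omit [CompactSpace G] [SecondCountableTopology G] in
/-- `τ_k` is measurable (coordinatewise left multiplication). -/
theorem measurable_layerTwist (k : ℤ) (g₀ : G) : Measurable (layerTwist (G := G) k g₀) := by
  refine measurable_pi_lambda _ fun e => ?_
  by_cases he : e.2 = 0 ∧ e.1 0 = k
  · have : (fun U : LGConfig 4 G => layerTwist k g₀ U e) = fun U => g₀ * U e := by
      funext U; simp only [layerTwist, he, and_self, if_true]
    rw [this]
    have h1 : Measurable (fun U : LGConfig 4 G => U e) := measurable_pi_apply e
    exact h1.const_mul g₀
  · have : (fun U : LGConfig 4 G => layerTwist k g₀ U e) = fun U => U e := by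
      funext U; simp only [layerTwist, he, if_false]
    rw [this]; exact measurable_pi_apply e

/-- **PROVED (discharges GEN 2's sorry).** `τ_k` intertwines the Wilson DLR kernels:
`(γ_Λ(·|η)).map τ_k = γ_Λ(·|τ_k η)` for EVERY finite `Λ`, every central `g₀`, every real `β` — gauge covariance
of the specification (tree `ymSpecification_map_gaugeTransformZd_holds`) and §0. -/
theorem ymSpecification_map_layerTwist (hρ : Continuous ρ) {g₀ : G} (hg : g₀ ∈ Subgroup.center G)
    (β : ℝ) (k : ℤ) (Λ : Finset (ZdEdge 4)) (η : LGConfig 4 G) :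
    (ymSpecification ρ β Λ η).map (layerTwist k g₀) = ymSpecification ρ β Λ (layerTwist k g₀ η) := by
  rw [layerTwist_eq_gaugeTransformZd hg]
  exact ymSpecification_map_gaugeTransformZd_holds ρ hρ β Λ η (slabGauge k g₀)

/-- **PROVED.** For a measurable observable of charge `c` under `τ_k`, `∫ g dγ_Λ(τ_k η) = c · ∫ g dγ_Λ(η)`. -/
theorem integral_charged_layerTwist (hρ : Continuous ρ) {g₀ : G} (hg : g₀ ∈ Subgroup.center G)
    (β : ℝ) (k : ℤ) (Λ : Finset (ZdEdge 4)) (η : LGConfig 4 G) {c : ℂ} {g : LGConfig 4 G → ℂ}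
    (hgm : Measurable g) (hcharged : ∀ U, g (layerTwist k g₀ U) = c * g U) :
    ∫ U, g U ∂(ymSpecification ρ β Λ (layerTwist k g₀ η)) = c * ∫ U, g U ∂(ymSpecification ρ β Λ η) := by
  rw [← ymSpecification_map_layerTwist ρ hρ hg β k Λ η,
    integral_map (measurable_layerTwist k g₀).aemeasurable hgm.aestronglyMeasurable]
  simp_rw [hcharged]
  exact integral_const_mul c _

/-- **PROVED. Twist-blindness of gauge-invariant tests:** `∫ f dγ_Λ(τ_k η) = ∫ f dγ_Λ(η)` whenever
`IsZdGaugeInvariant f` — the centre-twist row VANISHES on the gauge-invariant test class, for every group. -/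
theorem integral_layerTwist_eq_of_gaugeInvariant (hρ : Continuous ρ) {g₀ : G} (hg : g₀ ∈ Subgroup.center G)
    (β : ℝ) (k : ℤ) (Λ : Finset (ZdEdge 4)) (η : LGConfig 4 G) {f : LGConfig 4 G → ℝ}
    (hfm : Measurable f) (hfi : IsZdGaugeInvariant f) :
    ∫ U, f U ∂(ymSpecification ρ β Λ (layerTwist k g₀ η)) = ∫ U, f U ∂(ymSpecification ρ β Λ η) := by
  rw [← ymSpecification_map_layerTwist ρ hρ hg β k Λ η,
    integral_map (measurable_layerTwist k g₀).aemeasurable hfm.aestronglyMeasurable]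
  simp only [layerTwist_eq_gaugeTransformZd hg, hfi (slabGauge k g₀)]

end Symmetry

end Summit.QuantumFields.YangMills.Cruxes.IR.FixedMesh

end
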